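import Literature.Geometry.Kaehler.AnalyticSetComponentsProofs
import HarnessLib

/-!
# The components of the regular locus are locally finite (Chirka §5.1 Thm. (1))

Discharge of the named fact
`Literature.Geometry.Kaehler.IsAnalyticSet.finite_connectedComponentIn_regularLocus_inter_compact`
(`Literature/Geometry/Kaehler/AnalyticSetComponents.lean`, [Chirka1989, §5.1 Thm. (1), p. 52]):
for an analytic subset `Z` of a complex manifold, every compact set meets only finitely many
connected components of the regular locus `reg Z`:
`Literature.Geometry.Kaehler.IsAnalyticSet.finite_connectedComponentIn_regularLocus_inter_compact_holds`.

The proof runs along the proof of part (2) of the same theorem in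
`Literature/Geometry/Kaehler/AnalyticSetComponentsProofs.lean` (whose set-up is reused wholesale:
the closure-problem data `RegData`, the intersection dimension `IdimLE`, local analytic covers
`CoverSetup` / `IsCoverDisc` and their sheets, cover pieces and the equations of their closures),
and as in print it is an induction on the dimension, organised here as an induction on the
intersection dimension `IdimLE Z d` in the model space:

* Families of connected components (sets `connectedComponentIn R y`, `y ∈ R`, collected as
  `{T | (∃ b ∈ R, T = connectedComponentIn R b) ∧ (T ∩ V).Nonempty}` = the components of `R`
  meeting `V`) are counted by *anchors* (`Literature.Geometry.Kaehler.SCV.finite_of_anchors`: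
  distinct components are disjoint, so a family each of whose members contains one of finitely
  many nonempty sets is finite), which gives the restriction and transport lemmas
  `components_inter_finite`, `components_preimage_finite`.
* Easy cases (`RegData.locFin_of_notMem`, `locFin_of_mem_nhds`, `locFin_of_isolated`,
  `RegData.locFin_of_idimLE_zero`): off `Z`, at interior points and at isolated points at most
  one component is seen.
* The step over a local analytic cover (`CoverSetup.locFin_core`), with `Δ` the function of
  `exists_cover_structure` and `Z_G = Z ∩ {Δ ≠ 0}` the unramified part:
  **type I** components (meeting `Z_G`) all pass over any fixed good base point `z₀`
  (`CoverSetup.exists_sheet_mem_component`: the projection of `C ∩ Z_G` is relatively open and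
  closed in the preconnected base `{Δ ≠ 0}`, sheets being constant along components), so there
  are at most as many as sheets over `z₀` (`CoverSetup.components_ne_zero_finite`; in print: "the
  number of connected components of `S₀ᵖ` is finite (`≤ k`)");
  **type II** components `C` (inside `Z' = Z ∩ {Δ = 0}`, of smaller intersection dimension) are
  anchored at the sets `C' ∖ cl Z_G`, `C'` the component of `reg Z'` through a point of `C`
  (preconnected, made of regular points of `Z`, hence inside `C`; in print:
  `S_{ji} = S⁰_{ji} ∖ A_(p)`), and only finitely many `C'` are seen near the centre by the
  induction hypothesis.
* The induction `locFin_of_idimLE` and `RegData.locFin` (model space), the transfer to manifolds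
  through extended charts (`IsAnalyticSet.exists_nhds_finite_connectedComponentIn_regularLocus`)
  and compactness.

## References

* E. M. Chirka, *Complex Analytic Sets*, Kluwer (1989), Ch. 1 §5.1 Theorem (1) and its proof,
  p. 52–53 [Chirka1989].
-/

open Complex Metric Set Filter Function
open scoped Topology Real

namespace Literature.Geometry.Kaehler
namespace SCV

/-! ## Counting connected components -/

section Counting

variable {X : Type*} [TopologicalSpace X]

/-- **Counting components by anchors.** A family `𝒞` of connected components of `R` is finite as
soon as every member contains a nonempty "anchor" `Q d`, `d` ranging over a finite set: distinct
components are disjoint, so each anchor lies in at most one of them. [folklore] -/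
theorem finite_of_anchors {R : Set X} {𝒞 : Set (Set X)}
    (h𝒞 : ∀ C ∈ 𝒞, ∃ y ∈ R, C = connectedComponentIn R y) {α : Type*} {D : Set α}
    (hD : D.Finite) (Q : α → Set X) (hcov : ∀ C ∈ 𝒞, ∃ d ∈ D, (Q d).Nonempty ∧ Q d ⊆ C) :
    𝒞.Finite := by
  have hsub : 𝒞 ⊆ ⋃ d ∈ D, {C | C ∈ 𝒞 ∧ (Q d).Nonempty ∧ Q d ⊆ C} := by
    intro C hC
    obtain ⟨d, hd, hQne, hQC⟩ := hcov C hC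
    exact Set.mem_biUnion hd ⟨hC, hQne, hQC⟩
  refine (hD.biUnion fun d _ => Set.Subsingleton.finite ?_).subset hsub
  rintro C₁ ⟨hC₁, ⟨z, hz⟩, hQ₁⟩ C₂ ⟨hC₂, -, hQ₂⟩
  obtain ⟨y₁, -, rfl⟩ := h𝒞 C₁ hC₁
  obtain ⟨y₂, -, rfl⟩ := h𝒞 C₂ hC₂
  rw [connectedComponentIn_eq (hQ₁ hz), connectedComponentIn_eq (hQ₂ hz)]

/-- **Restriction.** If only finitely many components of `R ∩ U` meet `V`, then only finitely
many components of `R` meet `V ∩ U`: a component of `R ∩ U` is a preconnected subset of `R`,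
hence lies in a single component of `R`. [folklore] -/
theorem components_inter_finite {R U V : Set X}
    (h : {T | (∃ b ∈ R ∩ U, T = connectedComponentIn (R ∩ U) b) ∧ (T ∩ V).Nonempty}.Finite) :
    ({T | (∃ b ∈ R, T = connectedComponentIn R b) ∧ (T ∩ (V ∩ U)).Nonempty}).Finite := by
  refine finite_of_anchors (fun C hC => hC.1) h id ?_
  rintro C ⟨⟨y, -, rfl⟩, z, hzC, hzV, hzU⟩
  have hzR : z ∈ R := connectedComponentIn_subset _ _ hzC
  have hz' : z ∈ connectedComponentIn (R ∩ U) z := mem_connectedComponentIn ⟨hzR, hzU⟩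
  refine ⟨connectedComponentIn (R ∩ U) z, ⟨⟨z, ⟨hzR, hzU⟩, rfl⟩, z, hz', hzV⟩, ⟨z, hz'⟩, ?_⟩
  rw [connectedComponentIn_eq hzC]
  exact isPreconnected_connectedComponentIn.subset_connectedComponentIn hz'
    ((connectedComponentIn_subset _ _).trans Set.inter_subset_left)

/-- **Transport.** Let `e : X → Y` have a continuous left inverse `e'`. If only finitely many
components of `e '' R` meet `V`, then only finitely many components of `R` meet `e ⁻¹' V`: the
image under `e'` of a component of `e '' R` is a preconnected subset of `R`. [folklore] -/
theorem components_preimage_finite {Y : Type*} [TopologicalSpace Y] {e : X → Y} {e' : Y → X}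
    (he' : Continuous e') (hinv : ∀ x, e' (e x) = x) {R : Set X} {V : Set Y}
    (h : {T | (∃ b ∈ e '' R, T = connectedComponentIn (e '' R) b) ∧ (T ∩ V).Nonempty}.Finite) :
    {T | (∃ b ∈ R, T = connectedComponentIn R b) ∧ (T ∩ (e ⁻¹' V)).Nonempty}.Finite := by
  refine finite_of_anchors (fun C hC => hC.1) h (fun D => e' '' D) ?_
  rintro C ⟨⟨y, -, rfl⟩, z, hzC, hzV⟩
  have hzR : z ∈ R := connectedComponentIn_subset _ _ hzC
  have hez : e z ∈ e '' R := Set.mem_image_of_mem e hzR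
  have hz' : e z ∈ connectedComponentIn (e '' R) (e z) := mem_connectedComponentIn hez
  refine ⟨connectedComponentIn (e '' R) (e z), ⟨⟨e z, hez, rfl⟩, e z, hz', hzV⟩,
    ⟨z, e z, hz', hinv z⟩, ?_⟩
  rw [connectedComponentIn_eq hzC]
  refine (isPreconnected_connectedComponentIn.image _ he'.continuousOn).subset_connectedComponentIn
    ⟨e z, hz', hinv z⟩ ?_
  rintro _ ⟨w, hw, rfl⟩
  obtain ⟨x, hx, rfl⟩ := connectedComponentIn_subset _ _ hw
  rw [hinv]; exact hx

end Counting

/-! ## Local finiteness in the model space: easy cases -/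

section ModelEasy

open Literature.Analysis.Complex.SCV

variable {E : Type*} [NormedAddCommGroup E] [NormedSpace ℂ E]

/-- A single connected component of the regular locus is a relatively open and relatively
closed subset of it (a closure-problem datum `RegData`). [folklore] -/
theorem RegData.component [FiniteDimensional ℂ E] {W Z S : Set E} (h : RegData W Z S) (y : E) :
    RegData W Z (connectedComponentIn (regLocus Z) y) := by
  have := RegData.of_biUnion h.isOpen h.subset h.rel_closed h.zeroSetAt ({y} : Set E)
  rwa [Set.biUnion_singleton] at this

/-- **Off `Z` no component of the regular locus is seen.** [folklore] -/
theorem RegData.locFin_of_notMem {W Z S : Set E} (h : RegData W Z S) {a : E} (haW : a ∈ W)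
    (haZ : a ∉ Z) : ∃ V ∈ 𝓝 a,
      {T | (∃ b ∈ regLocus Z, T = connectedComponentIn (regLocus Z) b) ∧
        (T ∩ V).Nonempty}.Finite := by
  have hacl : a ∉ closure Z := fun hcl => haZ (h.rel_closed a haW hcl)
  refine ⟨(closure Z)ᶜ, isClosed_closure.isOpen_compl.mem_nhds hacl, Set.finite_empty.subset ?_⟩
  rintro C ⟨⟨y, -, rfl⟩, z, hzC, hzcl⟩
  exact (hzcl (subset_closure
    (regLocus_subset Z (_root_.connectedComponentIn_subset _ _ hzC)))).elim

/-- **Interior points**: if `Z` is a neighbourhood of `a`, a ball around `a` lies in a single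
component of the regular locus. [folklore] -/
theorem locFin_of_mem_nhds {Z : Set E} {a : E} (ha : Z ∈ 𝓝 a) :
    ∃ V ∈ 𝓝 a,
      {T | (∃ b ∈ regLocus Z, T = connectedComponentIn (regLocus Z) b) ∧
        (T ∩ V).Nonempty}.Finite := by
  obtain ⟨ρ, hρ, hball⟩ := Metric.mem_nhds_iff.1 ha
  have hreg : ball a ρ ⊆ regLocus Z := fun y hy =>
    ⟨hball hy, 0, isRegPt_zero_of_ball_subset hball hy⟩
  refine ⟨ball a ρ, ball_mem_nhds a hρ, finite_of_anchors (fun C hC => hC.1)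
    (Set.finite_singleton a) (fun _ => ball a ρ) ?_⟩
  rintro C ⟨⟨y, -, rfl⟩, z, hzC, hzB⟩
  refine ⟨a, Set.mem_singleton a, ⟨a, mem_ball_self hρ⟩, ?_⟩
  rw [connectedComponentIn_eq hzC]
  exact (convex_ball a ρ).isPreconnected.subset_connectedComponentIn hzB hreg

/-- **Isolated points**: near an isolated point of `Z` at most one component of the regular
locus is seen. [folklore] -/
theorem locFin_of_isolated {Z O : Set E} {a : E} (hO : IsOpen O) (haO : a ∈ O)
    (hZO : Z ∩ O ⊆ {a}) : ∃ V ∈ 𝓝 a,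
      {T | (∃ b ∈ regLocus Z, T = connectedComponentIn (regLocus Z) b) ∧
        (T ∩ V).Nonempty}.Finite := by
  refine ⟨O, hO.mem_nhds haO, finite_of_anchors (fun C hC => hC.1) (Set.finite_singleton a)
    (fun _ => {a}) ?_⟩
  rintro C ⟨⟨y, -, rfl⟩, z, hzC, hzO⟩
  have hza : z = a := hZO ⟨regLocus_subset Z (connectedComponentIn_subset _ _ hzC), hzO⟩
  exact ⟨a, Set.mem_singleton a, Set.singleton_nonempty a, Set.singleton_subset_iff.2 (hza ▸ hzC)⟩

/-- **Base of the induction: `IdimLE Z 0` means `Z` is discrete**, so near every point of `W`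
at most one component of the regular locus is seen. [folklore] -/
theorem RegData.locFin_of_idimLE_zero [FiniteDimensional ℂ E] {W Z S : Set E}
    (h : RegData W Z S) (h0 : IdimLE Z 0) {a : E} (haW : a ∈ W) :
    ∃ V ∈ 𝓝 a,
      {T | (∃ b ∈ regLocus Z, T = connectedComponentIn (regLocus Z) b) ∧
        (T ∩ V).Nonempty}.Finite := by
  by_cases haZ : a ∈ Z
  swap
  · exact h.locFin_of_notMem haW haZ
  obtain ⟨m, ι, hι, hdim, hiso⟩ := h0 a haZ
  -- `ι` is onto, hence an open map
  have hsurj : Function.Surjective ι := by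
    have h1 : Module.finrank ℂ (LinearMap.range (ι : (Fin m → ℂ) →ₗ[ℂ] E)) = m := by
      rw [LinearMap.finrank_range_of_inj hι, Module.finrank_fin_fun]
    have h3 : Module.finrank ℂ (LinearMap.range (ι : (Fin m → ℂ) →ₗ[ℂ] E)) ≤
        Module.finrank ℂ E := Submodule.finrank_le _
    have h2 : LinearMap.range (ι : (Fin m → ℂ) →ₗ[ℂ] E) = ⊤ :=
      Submodule.eq_top_of_finrank_eq (by omega)
    exact LinearMap.range_eq_top.1 h2
  haveI : CompleteSpace E := FiniteDimensional.complete ℂ E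
  have hopen : IsOpenMap fun w : Fin m → ℂ => a + ι w :=
    (isOpenMap_add_left a).comp (ι.isOpenMap hsurj)
  -- an open set isolating `a`
  obtain ⟨V, hV, hVo, h0V⟩ : ∃ V : Set (Fin m → ℂ), (∀ w ∈ V, w ≠ 0 → a + ι w ∉ Z) ∧ IsOpen V ∧
      (0 : Fin m → ℂ) ∈ V := by
    have := hiso
    rw [eventually_nhdsWithin_iff, _root_.eventually_nhds_iff] at this
    obtain ⟨V, hV, hVo, h0V⟩ := this
    exact ⟨V, fun w hw hne => hV w hw hne, hVo, h0V⟩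
  set O : Set E := (fun w : Fin m → ℂ => a + ι w) '' V with hOdef
  have hOo : IsOpen O := hopen V hVo
  have haO : a ∈ O := ⟨0, h0V, by simp⟩
  refine locFin_of_isolated hOo haO ?_
  rintro z ⟨hzZ, ⟨w, hwV, rfl⟩⟩
  have hw : w = 0 := by
    by_contra hne
    exact hV w hwV hne hzZ
  simp [hw]

end ModelEasy

/-! ## The induction step over a local analytic cover -/

section Core

open Literature.Analysis.Complex.SCV
open Literature.Analysis.Complex.SCV.CoverSetup

variable {E' : Type*} [NormedAddCommGroup E'] [NormedSpace ℂ E'] [FiniteDimensional ℂ E']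
  {m N : ℕ} {f : E' × (Fin (m + 1) → ℂ) → (Fin N → ℂ)} {a' : E'} {a'' : Fin (m + 1) → ℂ}
  {ε r C : ℝ} {F : Fin (m + 1) → E' × ℂ → ℂ} {rr RR : Fin (m + 1) → ℝ}

omit [FiniteDimensional ℂ E'] in
/-- **The base of the unramified part is preconnected**: the complement of the zero set of a
holomorphic function in a ball (`isPreconnected_inter_ne_zero_of_convex`).
[Chirka, *Complex Analytic Sets*, §2.2 Prop. 3] [folklore] -/
theorem isPreconnected_ball_inter_preimage_compl {Δ : E' → ℂ}
    (hΔ : DifferentiableOn ℂ Δ (ball a' ε)) : IsPreconnected (ball a' ε ∩ Δ ⁻¹' {0}ᶜ) := by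
  have h := isPreconnected_inter_ne_zero_of_convex (convex_ball a' ε) isOpen_ball
    (F := fun z (_ : Fin 1) => Δ z) (differentiableOn_pi.2 fun _ => hΔ)
  have heq : ball a' ε ∩ Δ ⁻¹' {0}ᶜ = ball a' ε ∩ {e | (fun _ : Fin 1 => Δ e) ≠ 0} := by
    ext z
    constructor
    · rintro ⟨h1, h2⟩
      exact ⟨h1, fun h0 => h2 (congrFun h0 0)⟩
    · rintro ⟨h1, h2⟩
      exact ⟨h1, fun h0 => h2 (funext fun _ => h0)⟩
  rw [heq]
  exact h

/-- **Every component of the regular locus meeting the unramified part passes over every good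
base point.** In the set-up of the local analytic cover (`CoverSetup`, `IsCoverDisc`), let `C`
be a connected component of the regular locus of `Z = coverZero …` containing a point over
`{Δ ≠ 0}`, and let `σ₁, …, σₙ` be the sheets of `Z` over a ball around a base point `z₀` with
`Δ z₀ ≠ 0`. Then `C` contains one of the points `(z₀, σⱼ z₀)`: the projection of `C ∩ {Δ ≠ 0}`
to the base is relatively open and closed in the preconnected set `G = ball ∩ {Δ ≠ 0}` (sheets
through a point of `C` stay in `C`, `CoverSetup.sheet_mem_iff`), hence is all of `G`.
[Chirka, *Complex Analytic Sets*, §5.1 (proof of the Theorem: the components of `S₀ᵖ` are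
components of a `k`-sheeted cover of `U' ∖ σ`)] [folklore] -/
theorem _root_.Literature.Analysis.Complex.SCV.CoverSetup.exists_sheet_mem_component
    (hS : CoverSetup f a' a'' ε r C F rr RR) {Δ : E' → ℂ} (hΔ : IsCoverDisc f a' a'' ε r rr Δ)
    {S : Set (E' × (Fin (m + 1) → ℂ))}
    (hR : RegData (polydisc a' a'' ε r) (coverZero f a' a'' ε r) S)
    {z₀ : E'} {δ : ℝ} (hδ : 0 < δ) (hB : ball z₀ δ ⊆ ball a' ε ∩ Δ ⁻¹' {0}ᶜ)
    {n : ℕ} {σ : Fin n → E' → (Fin (m + 1) → ℂ)}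
    (hσiff : ∀ z' ∈ ball z₀ δ, ∀ w, (z', w) ∈ coverZero f a' a'' ε r ↔ ∃ j, w = σ j z')
    {y : E' × (Fin (m + 1) → ℂ)}
    (hne : (connectedComponentIn (regLocus (coverZero f a' a'' ε r)) y ∩
      {x | Δ x.1 ≠ 0}).Nonempty) :
    ∃ j, (z₀, σ j z₀) ∈ connectedComponentIn (regLocus (coverZero f a' a'' ε r)) y := by
  classical
  set Zc := coverZero f a' a'' ε r with hZc
  set Cy := connectedComponentIn (regLocus Zc) y with hCy
  have hRC : RegData (polydisc a' a'' ε r) Zc Cy := hR.component y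
  set G : Set E' := ball a' ε ∩ Δ ⁻¹' {0}ᶜ with hG
  have hGc : IsPreconnected G := isPreconnected_ball_inter_preimage_compl hΔ.1
  -- the projection of `Cy ∩ {Δ ≠ 0}` to the base
  set B : Set E' := {z' | z' ∈ G ∧ ∃ w, (z', w) ∈ Cy} with hBdef
  have hBG : B ⊆ G := fun z hz => hz.1
  -- sheets through a point of `Cy` stay in `Cy`
  have key : ∀ z₁ ∈ G, ∃ δ₁ > 0, (∃ z ∈ ball z₁ δ₁, z ∈ B) → ball z₁ δ₁ ⊆ B := by
    intro z₁ hz₁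
    obtain ⟨δ₁, hδ₁, hδ₁sub, n₁, σ₁, -, hσ₁d, -, -, hσ₁iff⟩ :=
      hS.exists_sheets_nhds hΔ hz₁.1 hz₁.2
    refine ⟨δ₁, hδ₁, ?_⟩
    rintro ⟨z, hz, -, w, hwC⟩ z' hz'
    have hwZ : (z, w) ∈ Zc := regLocus_subset _ (connectedComponentIn_subset _ _ hwC)
    obtain ⟨j, rfl⟩ := (hσ₁iff z hz w).1 hwZ
    exact ⟨hδ₁sub hz', σ₁ j z',
      (hS.sheet_mem_iff hΔ hRC hδ₁sub hσ₁d hσ₁iff j hz hz').1 hwC⟩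
  have hBo : IsOpen B := by
    refine isOpen_iff_mem_nhds.2 fun z₁ hz₁ => ?_
    obtain ⟨δ₁, hδ₁, hball⟩ := key z₁ (hBG hz₁)
    exact Filter.mem_of_superset (ball_mem_nhds z₁ hδ₁) (hball ⟨z₁, mem_ball_self hδ₁, hz₁⟩)
  have hBcl : G ∩ closure B ⊆ B := by
    rintro z₂ ⟨hz₂G, hz₂cl⟩
    obtain ⟨δ₂, hδ₂, hball⟩ := key z₂ hz₂G
    obtain ⟨z₃, hz₃, hz₃B⟩ :=
      _root_.mem_closure_iff.1 hz₂cl (ball z₂ δ₂) isOpen_ball (mem_ball_self hδ₂)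
    exact hball ⟨z₃, hz₃, hz₃B⟩ (mem_ball_self hδ₂)
  have hBne : B.Nonempty := by
    obtain ⟨x, hxC, hxΔ⟩ := hne
    have hxZ : x ∈ Zc := regLocus_subset _ (connectedComponentIn_subset _ _ hxC)
    exact ⟨x.1, ⟨(mem_coverZero_iff.1 hxZ).1.1, hxΔ⟩, x.2, hxC⟩
  have hBeq : B = G :=
    eq_of_preconnected_of_relClopen hGc hBG hBne hBo (Set.inter_eq_right.2 hBG) hBcl
  have hz₀G : z₀ ∈ B := by
    rw [hBeq]
    exact hB (mem_ball_self hδ)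
  obtain ⟨-, w, hwC⟩ := hz₀G
  have hwZ : (z₀, w) ∈ Zc := regLocus_subset _ (connectedComponentIn_subset _ _ hwC)
  obtain ⟨j, rfl⟩ := (hσiff z₀ (mem_ball_self hδ) w).1 hwZ
  exact ⟨j, hwC⟩

/-- **Finitely many components of the regular locus meet the unramified part `{Δ ≠ 0}`** — at
most the number of sheets over a good base point (`exists_sheet_mem_component`).
[Chirka, *Complex Analytic Sets*, §5.1 (proof of the Theorem: "the number of connected
components of `S₀ᵖ` is finite (`≤ k`)")] [folklore] -/
theorem _root_.Literature.Analysis.Complex.SCV.CoverSetup.components_ne_zero_finite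
    (hS : CoverSetup f a' a'' ε r C F rr RR) {Δ : E' → ℂ} (hΔ : IsCoverDisc f a' a'' ε r rr Δ)
    {S : Set (E' × (Fin (m + 1) → ℂ))}
    (hR : RegData (polydisc a' a'' ε r) (coverZero f a' a'' ε r) S) :
    {T | (∃ b ∈ regLocus (coverZero f a' a'' ε r),
      T = connectedComponentIn (regLocus (coverZero f a' a'' ε r)) b) ∧
        (T ∩ {x | Δ x.1 ≠ 0}).Nonempty}.Finite := by
  obtain ⟨z₀, hΔz₀, hz₀⟩ : ∃ z₀, Δ z₀ ≠ 0 ∧ z₀ ∈ ball a' ε := by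
    have hfr : ∃ᶠ z in 𝓝 a', Δ z ≠ 0 := by
      simpa [Filter.EventuallyEq, Filter.not_eventually] using hΔ.2.1 a' (mem_ball_self hS.ε_pos)
    exact (hfr.and_eventually (isOpen_ball.mem_nhds (mem_ball_self hS.ε_pos))).exists
  obtain ⟨δ, hδ, hδsub, n, σ, -, -, -, -, hσiff⟩ := hS.exists_sheets_nhds hΔ hz₀ hΔz₀
  refine finite_of_anchors (fun C hC => hC.1) (Set.finite_univ (α := Fin n))
    (fun j => {((z₀, σ j z₀) : E' × (Fin (m + 1) → ℂ))}) ?_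
  rintro C ⟨⟨y, -, rfl⟩, hne⟩
  obtain ⟨j, hj⟩ := hS.exists_sheet_mem_component hΔ hR hδ hδsub hσiff hne
  exact ⟨j, Set.mem_univ j, Set.singleton_nonempty _, Set.singleton_subset_iff.2 hj⟩

/-- **The induction step of Chirka's §5.1 Theorem (1) over a local analytic cover.** In the
set-up `CoverSetup` (zero set `Z = coverZero` of `f` in the polydisc `U`, proper with finite
fibres over the base ball), assume local finiteness of the components of the regular locus for
all analytic sets of intersection dimension `≤ d` in `E' × ℂ^{m+1}` (`ih`) and
`dim (E' × ℂ^{m+1}) ≤ (m + 1) + (d + 1)`. Then some neighbourhood of the centre `(a', a'')`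
meets only finitely many components of `regLocus Z`. Proof (Chirka, loc. cit.): with `Δ` from
`exists_cover_structure`, the components meeting `Z_G = Z ∩ {Δ ≠ 0}` are finitely many
(`components_ne_zero_finite`). Every other component `C` lies in `Z' = Z ∩ {Δ = 0}`; a point `x`
of `C` is a regular point of `Z'` outside `Z_top = cl Z_G` (cut out by `Φ₀`,
`CoverPiece.closure_inter_eq`), and for the component `C'` of `reg Z'` through `x` the set
`C' ∖ Z_top` is preconnected (`isPreconnected_of_subset_closure_of_forall_nhds`, good
neighbourhoods) and consists of regular points of `Z`, so `C' ∖ Z_top ⊆ C`: the components of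
type II seen in `V` are anchored at the sets `C' ∖ Z_top` for the finitely many components `C'`
of `reg Z'` seen in `V` (induction hypothesis for `Z'`, of intersection dimension `≤ d` by
`idimLE_inter_disc_zero`). [cite: Chirka1989, §5.1 Thm. (1) (proof), p. 52–53] -/
theorem _root_.Literature.Analysis.Complex.SCV.CoverSetup.locFin_core
    (hS : CoverSetup f a' a'' ε r C F rr RR) {d : ℕ}
    (ih : ∀ (W Z S : Set (E' × (Fin (m + 1) → ℂ))), RegData W Z S → IdimLE Z d →
      ∀ a ∈ W, ∃ V ∈ 𝓝 a,
        {T | (∃ b ∈ regLocus Z, T = connectedComponentIn (regLocus Z) b) ∧ (T ∩ V).Nonempty}.Finite)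
    (hdim : Module.finrank ℂ (E' × (Fin (m + 1) → ℂ)) ≤ (m + 1) + (d + 1))
    {S : Set (E' × (Fin (m + 1) → ℂ))}
    (hR : RegData (polydisc a' a'' ε r) (coverZero f a' a'' ε r) S) :
    ∃ V ∈ 𝓝 ((a', a'') : E' × (Fin (m + 1) → ℂ)),
      {T | (∃ b ∈ regLocus (coverZero f a' a'' ε r),
        T = connectedComponentIn (regLocus (coverZero f a' a'' ε r)) b) ∧
          (T ∩ V).Nonempty}.Finite := by
  classical
  haveI : CompleteSpace E' := FiniteDimensional.complete ℂ E'
  obtain ⟨Δ, hΔ⟩ := hS.exists_isCoverDisc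
  set U := polydisc a' a'' ε r with hU
  set Zc := coverZero f a' a'' ε r with hZc
  set V : Set (E' × (Fin (m + 1) → ℂ)) := ball a' ε ×ˢ univ with hV
  have hUo : IsOpen U := isOpen_polydisc
  have haU : (a', a'') ∈ U := mk_mem_prod (mem_ball_self hS.ε_pos) (mem_ball_self hS.r_pos)
  have hZU : Zc ⊆ U := Set.inter_subset_left
  have hVo : IsOpen V := isOpen_ball.prod isOpen_univ
  have hUV : U ⊆ V := Set.prod_mono Subset.rfl (Set.subset_univ _)
  have hΔfst : DifferentiableOn ℂ (fun y : E' × (Fin (m + 1) → ℂ) => Δ y.1) V :=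
    hΔ.1.comp differentiableOn_fst fun y hy => hy.1
  set ZG := Zc ∩ {x | Δ x.1 ≠ 0} with hZG
  set Z' := Zc ∩ {x | Δ x.1 = 0} with hZ'
  -- all of `regLocus Zc` is a relatively clopen set
  have hR₀ : RegData U Zc (regLocus Zc) :=
    { isOpen := hR.isOpen, subset := hR.subset, rel_closed := hR.rel_closed,
      zeroSetAt := hR.zeroSetAt, S_subset := Subset.rfl,
      S_open := fun x _ => ⟨univ, Filter.univ_mem, Set.inter_subset_left⟩,
      S_closed := fun x hx _ => hx }
  have hZG_eq : regLocus Zc ∩ {x | Δ x.1 ≠ 0} = ZG := by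
    apply Set.Subset.antisymm (Set.inter_subset_inter_left _ (regLocus_subset _))
    exact fun x hx => ⟨hS.mem_regLocus_of_mem_coverZero hΔ hx.1 hx.2, hx.2⟩
  -- the equations of `cl Z_G`
  obtain ⟨M₀, Φ₀, hΦ₀d, hΦ₀⟩ := (hS.coverPiece hΔ hR₀).closure_inter_eq
  rw [hZG_eq] at hΦ₀
  -- `Z'` is an analytic subset of `U`
  have hZ'U : Z' ⊆ U := Set.inter_subset_left.trans hZU
  have hZ'V : Z' ⊆ V := hZ'U.trans hUV
  have hZ'cl : ∀ x ∈ U, x ∈ closure Z' → x ∈ Z' := by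
    intro x hxU hxcl
    refine ⟨hR.rel_closed x hxU (closure_mono Set.inter_subset_left hxcl), ?_⟩
    by_contra hne
    have hO : IsOpen (V ∩ (fun y : E' × (Fin (m + 1) → ℂ) => Δ y.1) ⁻¹' {0}ᶜ) :=
      hΔfst.continuousOn.isOpen_inter_preimage hVo isOpen_compl_singleton
    obtain ⟨y, ⟨-, hyΔ⟩, hyZ'⟩ := _root_.mem_closure_iff.1 hxcl _ hO ⟨hUV hxU, hne⟩
    exact hyΔ hyZ'.2
  have hZ'an : ∀ x ∈ U, IsZeroSetAt Z' x := by
    intro x hxU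
    refine (hR.zeroSetAt x hxU).inter ⟨V, hVo, hUV hxU, 1, fun y _ => Δ y.1,
      differentiableOn_pi.2 fun _ => hΔfst, ?_⟩
    ext y
    simp only [Set.mem_inter_iff, Set.mem_setOf_eq, Set.mem_preimage, Set.mem_singleton_iff]
    constructor
    · rintro ⟨hy0, hyV⟩; exact ⟨hyV, funext fun _ => hy0⟩
    · rintro ⟨hyV, hy0⟩; exact ⟨congrFun hy0 0, hyV⟩
  have hR' : RegData U Z' (⋃ x ∈ (∅ : Set (E' × (Fin (m + 1) → ℂ))),
      connectedComponentIn (regLocus Z') x) :=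
    RegData.of_biUnion hUo hZ'U hZ'cl hZ'an ∅
  -- the induction hypothesis for `Z'`, of intersection dimension `≤ d`
  obtain ⟨V₁, hV₁, hfin'⟩ := ih U Z' _ hR' (hS.idimLE_inter_disc_zero hΔ hdim) _ haU
  refine ⟨V₁, hV₁, ?_⟩
  -- `Φ₀` cuts out `cl Z_G` on `V`
  have hΦ₀iff : ∀ y ∈ V, Φ₀ y = 0 ↔ y ∈ closure ZG := fun y hy => by
    constructor
    · intro h0
      have : y ∈ V ∩ Φ₀ ⁻¹' {0} := ⟨hy, h0⟩
      rw [← hΦ₀] at this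
      exact this.1
    · intro hcl
      have : y ∈ closure ZG ∩ V := ⟨hcl, hy⟩
      rw [hΦ₀] at this
      exact this.2
  -- type II: components inside `Z'`, anchored at `C' ∩ {Φ₀ ≠ 0}`
  have hII : ∀ x ∈ regLocus Zc, connectedComponentIn (regLocus Zc) x ⊆ Z' →
      x ∈ regLocus Z' ∧ Φ₀ x ≠ 0 ∧
        connectedComponentIn (regLocus Z') x ∩ {y | Φ₀ y ≠ 0} ⊆
          connectedComponentIn (regLocus Zc) x := by
    intro x hxR hCZ'
    set Cx := connectedComponentIn (regLocus Zc) x with hCx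
    set C' := connectedComponentIn (regLocus Z') x with hC'
    obtain ⟨hxZ, p, hp⟩ := hxR
    have hxU : x ∈ U := hZU hxZ
    obtain ⟨Nn, K, ρ, Ψ₀, hxN, -, -, hG⟩ := hp.exists_goodNhd hxZ Filter.univ_mem
    have hZN : Zc ∩ Nn ⊆ Cx :=
      inter_subset_connectedComponentIn_regLocus hxZ hxN hG.isPreconnected hG.subset_regLocus
    -- (a) `x` is a regular point of `Z'`
    have hxR' : x ∈ regLocus Z' := by
      have hZ'N : Zc ∩ Nn = Z' ∩ Nn :=
        Set.Subset.antisymm (fun y hy => ⟨hCZ' (hZN hy), hy.2⟩)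
          (Set.inter_subset_inter_left _ Set.inter_subset_left)
      exact ⟨hCZ' (mem_connectedComponentIn ⟨hxZ, p, hp⟩), p, hp.congr hG.isOpen hxN hZ'N⟩
    -- (b) `x ∉ cl Z_G`, i.e. `Φ₀ x ≠ 0`
    have hx_ncl : x ∉ closure ZG := by
      intro hcl
      obtain ⟨y, hyN, hyZ, hyΔ⟩ := _root_.mem_closure_iff.1 hcl Nn hG.isOpen hxN
      exact hyΔ (hCZ' (hZN ⟨hyZ, hyN⟩)).2
    have hΦ₀x : Φ₀ x ≠ 0 := fun h0 => hx_ncl ((hΦ₀iff x (hUV hxU)).1 h0)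
    refine ⟨hxR', hΦ₀x, ?_⟩
    -- (c) `C' ∩ {Φ₀ ≠ 0}` is a preconnected set of regular points of `Zc` containing `x`
    have h6e : C' ⊆ closure (C' ∩ {y | Φ₀ y ≠ 0}) :=
      connectedComponentIn_subset_closure_ne_zero hZ'V hΦ₀d
        ⟨x, mem_connectedComponentIn hxR', hΦ₀x⟩
    have hC'U : C' ⊆ U := (connectedComponentIn_subset _ _).trans ((regLocus_subset Z').trans hZ'U)
    have hQreg : C' ∩ {y | Φ₀ y ≠ 0} ⊆ regLocus Zc := by
      rintro y ⟨hyC', hyΦ⟩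
      have hyU := hC'U hyC'
      have hy_ncl : y ∉ closure ZG := fun h => hyΦ ((hΦ₀iff y (hUV hyU)).2 h)
      obtain ⟨hyZ', q, hq⟩ := connectedComponentIn_subset _ _ hyC'
      obtain ⟨O, hOo, hyO, hO⟩ : ∃ O : Set (E' × (Fin (m + 1) → ℂ)), IsOpen O ∧ y ∈ O ∧
          O ∩ ZG = ∅ := by
        have := hy_ncl
        rw [_root_.mem_closure_iff] at this
        push Not at this
        obtain ⟨O, hOo, hyO, hO⟩ := this
        exact ⟨O, hOo, hyO, hO⟩
      have hZO : Z' ∩ O = Zc ∩ O := by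
        refine Set.Subset.antisymm (Set.inter_subset_inter_left _ Set.inter_subset_left)
          fun z hz => ⟨⟨hz.1, ?_⟩, hz.2⟩
        by_contra hΔz
        have : z ∈ O ∩ ZG := ⟨hz.2, hz.1, hΔz⟩
        rw [hO] at this
        exact this
      exact ⟨hyZ'.1, q, hq.congr hOo hyO hZO⟩
    have hQconn : IsPreconnected (C' ∩ {y | Φ₀ y ≠ 0}) := by
      refine isPreconnected_of_subset_closure_of_forall_nhds isPreconnected_connectedComponentIn
        Set.inter_subset_left h6e fun y hyC' => ?_
      obtain ⟨hyZ', q, hq⟩ := connectedComponentIn_subset _ _ hyC'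
      obtain ⟨Nn', K', ρ', Ψ₀', hyN, -, -, hG'⟩ := hq.exists_goodNhd hyZ' Filter.univ_mem
      refine ⟨Nn', hG'.isOpen.mem_nhds hyN, ?_⟩
      have h1 : Z' ∩ Nn' ⊆ C' := by
        rw [hC', connectedComponentIn_eq hyC']
        exact inter_subset_connectedComponentIn_regLocus hyZ' hyN hG'.isPreconnected
          hG'.subset_regLocus
      have hNC' : Nn' ∩ (C' ∩ {y | Φ₀ y ≠ 0}) = (Z' ∩ Nn') ∩ {y | Φ₀ y ≠ 0} := by
        ext z
        constructor
        · rintro ⟨hzN, hzC', hzΦ⟩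
          exact ⟨⟨regLocus_subset _ (connectedComponentIn_subset _ _ hzC'), hzN⟩, hzΦ⟩
        · rintro ⟨⟨hzZ', hzN⟩, hzΦ⟩
          exact ⟨hzN, h1 ⟨hzZ', hzN⟩, hzΦ⟩
      rw [hNC']
      exact hG'.isPreconnected_inter_ne_zero (Set.inter_subset_left.trans hZ'V) hΦ₀d
    exact hQconn.subset_connectedComponentIn ⟨mem_connectedComponentIn hxR', hΦ₀x⟩ hQreg
  -- splitting the components meeting `V₁` into the two types
  have hsplit :
      {T | (∃ b ∈ regLocus Zc, T = connectedComponentIn (regLocus Zc) b) ∧ (T ∩ V₁).Nonempty} ⊆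
        {T | (∃ b ∈ regLocus Zc, T = connectedComponentIn (regLocus Zc) b) ∧
          (T ∩ {x | Δ x.1 ≠ 0}).Nonempty} ∪
        {T | ((∃ b ∈ regLocus Zc, T = connectedComponentIn (regLocus Zc) b) ∧
          (T ∩ V₁).Nonempty) ∧ T ⊆ Z'} := by
    rintro C ⟨⟨y, hy, rfl⟩, hCV⟩
    by_cases hI : (connectedComponentIn (regLocus Zc) y ∩ {x | Δ x.1 ≠ 0}).Nonempty
    · exact Or.inl ⟨⟨y, hy, rfl⟩, hI⟩
    · refine Or.inr ⟨⟨⟨y, hy, rfl⟩, hCV⟩, fun z hz =>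
        ⟨regLocus_subset _ (connectedComponentIn_subset _ _ hz), ?_⟩⟩
      by_contra hne
      exact hI ⟨z, hz, hne⟩
  refine ((hS.components_ne_zero_finite hΔ hR).union ?_).subset hsplit
  refine finite_of_anchors (fun C hC => hC.1.1) hfin' (fun C' => C' ∩ {y | Φ₀ y ≠ 0}) ?_
  rintro C ⟨⟨⟨x₀, -, rfl⟩, x, hxC, hxV₁⟩, hCZ'⟩
  have hxR : x ∈ regLocus Zc := connectedComponentIn_subset _ _ hxC
  rw [connectedComponentIn_eq hxC] at hCZ' ⊢
  obtain ⟨hxR', hΦ₀x, hQ⟩ := hII x hxR hCZ'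
  exact ⟨connectedComponentIn (regLocus Z') x,
    ⟨⟨x, hxR', rfl⟩, x, mem_connectedComponentIn hxR', hxV₁⟩,
    ⟨x, mem_connectedComponentIn hxR', hΦ₀x⟩, hQ⟩

end Core

/-! ## Local finiteness in the model space -/

section ModelTheorem

open Literature.Analysis.Complex.SCV

/-- **The induction on the intersection dimension.** For every `d`: in every finite-dimensional
complex normed space, for every analytic subset `Z` of an open set `W` (closure-problem data
`RegData W Z S`) with `IdimLE Z d`, every point of `W` has a neighbourhood meeting only finitely
many connected components of `regLocus Z`. [cite: Chirka1989, §5.1 Thm. (1), p. 52–53] -/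
theorem locFin_of_idimLE (d : ℕ) :
    ∀ {E : Type*} [NormedAddCommGroup E] [NormedSpace ℂ E] [FiniteDimensional ℂ E]
      {W Z S : Set E}, RegData W Z S → IdimLE Z d →
        ∀ a ∈ W, ∃ V ∈ 𝓝 a, {T | (∃ b ∈ regLocus Z, T = connectedComponentIn (regLocus Z) b) ∧
          (T ∩ V).Nonempty}.Finite := by
  induction d with
  | zero =>
    intro E _ _ _ W Z S hR h0 a haW
    exact hR.locFin_of_idimLE_zero h0 haW
  | succ d ih =>
    intro E _ _ _ W Z S hR hd a haW
    -- easy cases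
    by_cases haZ : a ∈ Z
    swap
    · exact hR.locFin_of_notMem haW haZ
    by_cases hnhds : Z ∈ 𝓝 a
    · exact locFin_of_mem_nhds hnhds
    -- an injective `ι : ℂ^{m'+1} → E` with `a` isolated in `Z ∩ (a + range ι)`
    obtain ⟨m', ι, hι, hdim, hiso⟩ : ∃ (m' : ℕ) (ι : (Fin (m' + 1) → ℂ) →L[ℂ] E),
        Function.Injective ι ∧ Module.finrank ℂ E ≤ (m' + 1) + (d + 1) ∧
        ∀ᶠ w in 𝓝[≠] (0 : Fin (m' + 1) → ℂ), a + ι w ∉ Z := by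
      obtain ⟨m, ι, hι, hdim, hiso⟩ := hd a haZ
      cases m with
      | zero =>
        obtain ⟨v, hv, hev⟩ := exists_line_isolated (hR.zeroSetAt a haW) haZ hnhds
        obtain ⟨hinj, hiso'⟩ := exists_lineEmb_of_isolated (Z := Z) hv hev
        exact ⟨0, lineEmb v, hinj, by omega, hiso'⟩
      | succ m' => exact ⟨m', ι, hι, hdim, hiso⟩
    -- adapted coordinates
    obtain ⟨K, Θ, hΘι⟩ := exists_equiv_adapted ι hι
    have hRt := hR.image_equiv Θ
    have hdt := hd.image_equiv Θ
    set at' : K := (Θ a).1 with hat'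
    set at'' : Fin (m' + 1) → ℂ := (Θ a).2 with hat''
    have hΘa : Θ a = (at', at'') := rfl
    -- global equations of `Θ '' Z` near `Θ a`
    obtain ⟨U₀, hU₀o, haU₀, N, f, hf, hZU₀⟩ := (hR.zeroSetAt a haW).image_equiv Θ
    obtain ⟨U₁, hU₁o, haU₁, hU₁W, hU₁U₀⟩ : ∃ U₁ : Set (K × (Fin (m' + 1) → ℂ)), IsOpen U₁ ∧
        Θ a ∈ U₁ ∧ U₁ ⊆ Θ '' W ∧ U₁ ⊆ U₀ :=
      ⟨U₀ ∩ Θ '' W, hU₀o.inter hRt.isOpen, ⟨haU₀, Set.mem_image_of_mem Θ haW⟩,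
        Set.inter_subset_right, Set.inter_subset_left⟩
    -- isolation of `at''` in the fibre of `Θ '' Z` over `at'`
    have hisoT : ∀ᶠ w in 𝓝[≠] at'', f (at', w) ≠ 0 := by
      have hpt : ∀ w, ((at', w) : K × (Fin (m' + 1) → ℂ)) = Θ (a + ι (w - at'')) := by
        intro w
        rw [map_add, hΘι, hΘa, Prod.mk_add_mk, add_zero, add_sub_cancel]
      have ht : Tendsto (fun w : Fin (m' + 1) → ℂ => w - at'') (𝓝[≠] at'') (𝓝[≠] 0) := by
        refine tendsto_nhdsWithin_of_tendsto_nhds_of_eventually_within _ ?_ ?_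
        · have : Tendsto (fun w : Fin (m' + 1) → ℂ => w - at'') (𝓝 at'') (𝓝 (at'' - at'')) :=
            (continuous_id.sub continuous_const).continuousAt
          rw [sub_self] at this
          exact this.mono_left nhdsWithin_le_nhds
        · exact eventually_nhdsWithin_of_forall fun w hw h0 => hw (sub_eq_zero.1 h0)
      have hmemU₀ : ∀ᶠ w in 𝓝[≠] at'', ((at', w) : K × (Fin (m' + 1) → ℂ)) ∈ U₀ := by
        have hc : Continuous fun w : Fin (m' + 1) → ℂ => ((at', w) : K × (Fin (m' + 1) → ℂ)) := by
          fun_prop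
        exact nhdsWithin_le_nhds (hc.continuousAt.preimage_mem_nhds (hU₀o.mem_nhds (hΘa ▸ haU₀)))
      filter_upwards [ht.eventually hiso, hmemU₀] with w hw hwU₀ hf0
      apply hw
      have hmem : ((at', w) : K × (Fin (m' + 1) → ℂ)) ∈ (Θ '' Z) ∩ U₀ := by
        rw [hZU₀]; exact ⟨hwU₀, hf0⟩
      obtain ⟨z, hzZ, hz⟩ := hmem.1
      rw [hpt w] at hz
      exact Θ.injective hz ▸ hzZ
    -- the cover set-up at `Θ a`
    obtain ⟨ε, r, C, F, rr, RR, hS, hsubU₁⟩ :=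
      exists_coverSetup hU₁o (hf.mono hU₁U₀) haU₁ hisoT
    -- restrict the transported problem to the polydisc
    have hpolyW : polydisc at' at'' ε r ⊆ Θ '' W := fun x hx =>
      hU₁W (hsubU₁ ⟨hx.1, ball_subset_closedBall hx.2⟩)
    have hRp := hRt.restrict isOpen_polydisc hpolyW
    have hZeq : Θ '' Z ∩ polydisc at' at'' ε r = coverZero f at' at'' ε r := by
      have hpU₀ : polydisc at' at'' ε r ⊆ U₀ := fun x hx =>
        hU₁U₀ (hsubU₁ ⟨hx.1, ball_subset_closedBall hx.2⟩)
      ext x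
      constructor
      · rintro ⟨hxZ, hxp⟩
        exact ⟨hxp, (hZU₀.subset ⟨hxZ, hpU₀ hxp⟩).2⟩
      · rintro ⟨hxp, hx0⟩
        exact ⟨(hZU₀.symm.subset ⟨hpU₀ hxp, hx0⟩).1, hxp⟩
    rw [hZeq] at hRp
    -- the core step
    have hdimK : Module.finrank ℂ (K × (Fin (m' + 1) → ℂ)) ≤ (m' + 1) + (d + 1) := by
      rwa [← Θ.toLinearEquiv.finrank_eq]
    obtain ⟨V, hV, hfin⟩ := hS.locFin_core (fun W Z S h1 h2 => ih h1 h2) hdimK hRp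
    -- back to `Z`
    have hapoly : ((at', at'') : K × (Fin (m' + 1) → ℂ)) ∈ polydisc at' at'' ε r :=
      mk_mem_prod (mem_ball_self hS.ε_pos) (mem_ball_self hS.r_pos)
    rw [← hZeq, regLocus_inter_of_isOpen isOpen_polydisc, regLocus_image_equiv] at hfin
    have h2 : {T | (∃ b ∈ Θ '' regLocus Z, T = connectedComponentIn (Θ '' regLocus Z) b) ∧
        (T ∩ (V ∩ polydisc at' at'' ε r)).Nonempty}.Finite :=
      components_inter_finite hfin
    have h3 : {T | (∃ b ∈ regLocus Z, T = connectedComponentIn (regLocus Z) b) ∧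
        (T ∩ (Θ ⁻¹' (V ∩ polydisc at' at'' ε r))).Nonempty}.Finite :=
      components_preimage_finite (e := Θ) (e' := Θ.symm) Θ.symm.continuous
        Θ.symm_apply_apply h2
    refine ⟨Θ ⁻¹' (V ∩ polydisc at' at'' ε r), ?_, h3⟩
    refine Θ.continuous.continuousAt.preimage_mem_nhds (Filter.inter_mem ?_ ?_)
    · rw [hΘa]; exact hV
    · rw [hΘa]; exact isOpen_polydisc.mem_nhds hapoly

/-- **The components of the regular locus are locally finite (model space).** Let `Z` be an
analytic subset of an open set `W` of a finite-dimensional complex normed space (closure-problem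
data `RegData W Z S`). Then every point of `W` has a neighbourhood meeting only finitely many
connected components of `regLocus Z`; the intersection dimension hypothesis of the induction
`locFin_of_idimLE` is vacuous for `d = dim E`. [cite: Chirka1989, §5.1 Thm. (1), p. 52–53] -/
theorem RegData.locFin {E : Type*} [NormedAddCommGroup E] [NormedSpace ℂ E]
    [FiniteDimensional ℂ E] {W Z S : Set E} (h : RegData W Z S) {a : E} (ha : a ∈ W) :
    ∃ V ∈ 𝓝 a,
      {T | (∃ b ∈ regLocus Z, T = connectedComponentIn (regLocus Z) b) ∧
        (T ∩ V).Nonempty}.Finite := by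
  refine locFin_of_idimLE (Module.finrank ℂ E) h (fun x _ => ?_) a ha
  refine ⟨0, 0, fun u v _ => Subsingleton.elim u v, by omega, ?_⟩
  have hempty : ({(0 : Fin 0 → ℂ)}ᶜ : Set (Fin 0 → ℂ)) = ∅ := by
    ext u; simp [Subsingleton.elim u 0]
  show ∀ᶠ w in 𝓝[{(0 : Fin 0 → ℂ)}ᶜ] 0, x + (0 : (Fin 0 → ℂ) →L[ℂ] E) w ∉ Z
  rw [hempty, nhdsWithin_empty]
  exact Filter.eventually_bot

end ModelTheorem

end SCV

/-! ## Transfer to complex manifolds: Chirka §5.1 Thm. (1) -/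

section Manifold

open scoped Manifold ContDiff
open SCV Literature.Analysis.Complex.SCV

variable {E : Type*} [NormedAddCommGroup E] [NormedSpace ℂ E]
  {H : Type*} [TopologicalSpace H] {I : ModelWithCorners ℂ E H}
  {M : Type*} [TopologicalSpace M] [ChartedSpace H M]

/-- **Local finiteness of the components of the regular locus at a point of a complex
manifold.** For an analytic subset `Z` of a complex manifold and any point `x`, some
neighbourhood of `x` meets only finitely many connected components of `regularLocus I Z`: in the
extended chart at `x` the chart image of `Z` is an analytic subset of the chart target, to which
the model-space theorem `Literature.Geometry.Kaehler.SCV.RegData.locFin` applies, and the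
inverse chart maps components of the regular locus of the chart image to preconnected subsets of
`regularLocus I Z` (anchors, `Literature.Geometry.Kaehler.SCV.finite_of_anchors`).
[cite: Chirka1989, §5.1 Thm. (1), p. 52–53] -/
theorem IsAnalyticSet.exists_nhds_finite_connectedComponentIn_regularLocus
    [FiniteDimensional ℂ E] [IsManifold I 1 M] [I.Boundaryless] {Z : Set M}
    (hZ : IsAnalyticSet I Z) (x : M) :
    ∃ V ∈ 𝓝 x, {S : Set M | (∃ y ∈ regularLocus I Z,
      S = connectedComponentIn (regularLocus I Z) y) ∧ (S ∩ V).Nonempty}.Finite := by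
  set c := extChartAt I x with hc
  have hxs : x ∈ c.source := mem_extChartAt_source x
  -- the chart image of `Z` is an analytic subset of the chart target
  have hR : RegData c.target (chartImage I x Z) ∅ := by
    refine ⟨isOpen_extChartAt_target x, Set.inter_subset_left, fun e he hecl => ⟨he, ?_⟩,
      fun e he => ?_, Set.empty_subset _, fun e he => he.elim, fun e _ hecl => ?_⟩
    · -- relatively closed
      have h1 := (continuousAt_extChartAt_symm'' he).continuousWithinAt.mem_closure_image
        (s := chartImage I x Z) hecl
      have h2 : c.symm '' chartImage I x Z ⊆ Z := by rintro _ ⟨e', he', rfl⟩; exact he'.2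
      exact hZ.isClosed.closure_subset (closure_mono h2 h1)
    · -- analytic
      have := (hZ (c.symm e)).isZeroSetAt_chartImage (x := x) (c.map_target he)
      rwa [c.right_inv he] at this
    · rw [closure_empty] at hecl
      exact hecl
  obtain ⟨V, hV, hfin⟩ := hR.locFin (c.map_source hxs)
  -- pull the neighbourhood back to `M`
  refine ⟨c.source ∩ c ⁻¹' V, Filter.inter_mem ((isOpen_extChartAt_source x).mem_nhds hxs)
    ((continuousAt_extChartAt x).preimage_mem_nhds hV), ?_⟩
  refine finite_of_anchors (R := regularLocus I Z) (fun C hC => hC.1) hfin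
    (fun D => c.symm '' D) ?_
  rintro C ⟨⟨y, -, rfl⟩, z, hzC, hzs, hzV⟩
  have hzR : z ∈ regularLocus I Z := connectedComponentIn_subset _ _ hzC
  have hez : c z ∈ regLocus (chartImage I x Z) :=
    (mem_regLocus_chartImage_iff (c.map_source hzs)).2 (by rw [c.left_inv hzs]; exact hzR)
  have hz' : c z ∈ connectedComponentIn (regLocus (chartImage I x Z)) (c z) :=
    mem_connectedComponentIn hez
  refine ⟨connectedComponentIn (regLocus (chartImage I x Z)) (c z),
    ⟨⟨c z, hez, rfl⟩, c z, hz', hzV⟩, ⟨z, c z, hz', c.left_inv hzs⟩, ?_⟩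
  rw [connectedComponentIn_eq hzC]
  have hDt : connectedComponentIn (regLocus (chartImage I x Z)) (c z) ⊆ c.target := fun e he =>
    (regLocus_subset _ (connectedComponentIn_subset _ _ he)).1
  refine (isPreconnected_connectedComponentIn.image _
    ((continuousOn_extChartAt_symm x).mono hDt)).subset_connectedComponentIn
    ⟨c z, hz', c.left_inv hzs⟩ ?_
  rintro _ ⟨e, he, rfl⟩
  exact (mem_regLocus_chartImage_iff (hDt he)).1 (connectedComponentIn_subset _ _ he)

variable (I) (M) in
/-- **Chirka §5.1 Theorem, part (1), discharged**: for an analytic subset `Z` of a complex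
manifold, the decomposition of the regular locus `reg Z` into connected components is locally
finite — every compact set `K` meets only finitely many components. Proof: local finiteness at
every point (`IsAnalyticSet.exists_nhds_finite_connectedComponentIn_regularLocus`, Chirka's
induction over local analytic covers in a chart) and a finite subcover of `K`.
[cite: Chirka1989, §5.1 Thm. (1), p. 52–53] -/
theorem IsAnalyticSet.finite_connectedComponentIn_regularLocus_inter_compact_holds :
    IsAnalyticSet.finite_connectedComponentIn_regularLocus_inter_compact I M := by
  intro _ _ _ Z hZ K hK
  choose V hV hfin using fun x : M =>
    hZ.exists_nhds_finite_connectedComponentIn_regularLocus x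
  obtain ⟨t, -, htK⟩ := hK.elim_nhds_subcover V fun x _ => hV x
  refine (t.finite_toSet.biUnion fun x _ => hfin x).subset ?_
  rintro S ⟨hS, z, hzS, hzK⟩
  obtain ⟨x, hxt, hzV⟩ := Set.mem_iUnion₂.1 (htK hzK)
  exact Set.mem_iUnion₂.2 ⟨x, hxt, hS, z, hzS, hzV⟩

end Manifold

end Literature.Geometry.Kaehler
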